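import Summits.QuantumFields.YangMills.Theorems.IR.ShellMaxCorrTorusGram
import Summits.QuantumFields.YangMills.Theorems.IR.ShellMaxCorrTransfer
import Summits.QuantumFields.YangMills.Theorems.IR.ShellMaxCorrRungReduction

/-!
# Crux `IR` (item stmt-QuantumFields-19354) — line «maximal correlation at one physical thickness»:
THE STRONG-COUPLING RUNG `ShellRung` (registered stub `ShellMaxCorr.stub_shellRung`)

Prover file for item `stmt-QuantumFields-19354` (lead prover ym-ir-line-mxc-p1, g2; `--supports`, proves the registered stub
`stub_shellRung : ShellRung` of the skeleton `Cruxes/IR/Lines/shell_maxcorr_doubling.lean` BY NAME).  `ShellRung`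
(`Theorems/IR/ShellMaxCorrDefs.lean`): for every compact metrisable gauge group `G` and continuous representation `ρ` there
is `β₀ > 0` such that for `|β| ≤ β₀`, on EVERY odd torus and for EVERY inner radius `R`, the Hirschfeld–Gebelein–Rényi
maximal correlation between the links of the ball `B_R` and the links outside `B_{R+1}` under the torus Wilson measure is
`≤ 1/2` (`ShellCorrBound ρ β (2S+1) R 1 (1/2)`).  The radius-uniformity — the part the ideator and g0 found in no printed
theorem (Dobrushin–Künsch–Föllmer estimates carry oscillation norms) — comes from the g2 route:

 (P) Dobrushin ⇒ dimension-free Poincaré for the heat bath (`…ShellMaxCorrPoincare.lean`),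
 (B) Poincaré + Bessel/Schur ⇒ `Var_μ(E[f|𝓕_B]) ≤ (KΛ/((1−α)ρlo²)) Var_μ f` (`…ShellMaxCorrTransfer.lean`),
 (H1)(H2) one-link boundary changes are bounded local tilts (`…ShellMaxCorrBoundaryTilt.lean`),
 (H3) Gram rows `Λ = O(δ²)` (`…ShellMaxCorrTorusGram.lean`, Dobrushin comparison with the super-solution of
      `…ShellMaxCorrTorusCount.lean`),

applied to the torus Wilson measure = the Gibbs measure of the torus weight specification of `v_β = exp(−β Re tr(1−ρ))`
(`wilsonMeasure_eq_groupHeatKernelMeasure_rep` below + the tree's `isGibbsMeasure_groupHeatKernelMeasure`), with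
`osc(log v_β) ≤ δ = 2‖Re tr ρ‖_∞ |β|`: `Var_μ(E[f | links outside B_{R+1}]) ≤ ¼ Var_μ(f)` once `δ` is small (a continuity-at-0
choice of `β₀`, no optimisation of constants), whence `|Cov(f,g)| = |Cov(E[f|𝓕_B], g)| ≤ ½ σ(f) σ(g)`.

HONEST FRAMING: a strong-coupling (`|β| ≤ β₀(ρ)`, `β₀` tiny and inexplicit) statement about finite tori; it is the BC5 format
rung of a CONDITIONAL rung line and says nothing at weak coupling: the loads `stub_shellCert` / `IRShellCorr`, the crux `IR`,
and the Clay Yang–Mills mass gap are untouched (R4 closes only the finite-𝕋⁴ rung `BalabanLadder.UV`).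
-/

set_option autoImplicit false

noncomputable section

open MeasureTheory ProbabilityTheory Finset Function Filter Real Topology
open Literature.Probability.LatticeModels Literature.Probability.LatticeModels.DobrushinMetric
open Literature.MathematicalPhysics.QuantumLattice (groupHeatKernelMeasure groupHeatKernelMeasure_eq
  groupHeatKernelWeight)
open Literature.MathematicalPhysics.QuantumFieldTheory
open Summit.QuantumFields.YangMills.Cruxes.IR.ShellMaxCorr.HeatBath
open Summit.QuantumFields.YangMills.Cruxes.IR.ShellMaxCorr.TorusTilt

namespace Summit.QuantumFields.YangMills.Cruxes.IR.ShellMaxCorr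

/-! ## §1 The torus Wilson measure is the plaquette-weight measure of `v_β = exp(−β Re tr(1 − ρ))` -/

section Bridge

variable {d L : ℕ} [NeZero L] {G : Type*} [Group G] [TopologicalSpace G] [IsTopologicalGroup G]
  [CompactSpace G] [MeasurableSpace G] [BorelSpace G] {n : ℕ}

/-- **The torus Wilson measure of `ρ` at `β` is the plaquette-weight measure of `v_β(g) = exp(−β (n − Re tr ρ(g)))`**
(both are `Z⁻¹ exp(−β S_W) ∏ dHaar`; `exp ∑ = ∏ exp`; cf. the tree's `SU(N)` case `wilsonMeasure_eq_groupHeatKernelMeasure`). -/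
theorem wilsonMeasure_eq_groupHeatKernelMeasure_rep (ρ : G →* Matrix (Fin n) (Fin n) ℂ) (β : ℝ) :
    wilsonMeasure (d := d) (L := L) ρ β =
      groupHeatKernelMeasure (d := d) (L := L)
        (fun _ : ℝ => fun g : G => Real.exp (-(β * ((n : ℝ) - (ρ g).trace.re)))) 0 := by
  have hw : ∀ U : GaugeConfig d L G,
      groupHeatKernelWeight (d := d) (L := L) (fun _ : ℝ => fun g : G => Real.exp (-(β * ((n : ℝ) - (ρ g).trace.re))))
        0 U = Real.exp (-β * wilsonAction ρ U) := by
    intro U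
    simp only [groupHeatKernelWeight, wilsonAction, neg_mul, Finset.mul_sum, ← Real.exp_sum, Finset.sum_neg_distrib]
  unfold wilsonMeasure partitionFunction wilsonWeight
  rw [groupHeatKernelMeasure_eq]
  simp only [hw]

end Bridge

/-! ## §2 The rung -/

section Rung

/-- A real function continuous at `0` with negative value there is negative on a neighbourhood: quantitative form. -/
theorem exists_pos_forall_lt_of_continuousAt {Ψ : ℝ → ℝ} (hΨ : ContinuousAt Ψ 0) (h0 : Ψ 0 < 0) :
    ∃ ε : ℝ, 0 < ε ∧ ∀ t : ℝ, |t| < ε → Ψ t < 0 := by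
  have hev : ∀ᶠ t in 𝓝 (0 : ℝ), Ψ t < 0 := hΨ.eventually (Iio_mem_nhds h0)
  obtain ⟨ε, hε, h⟩ := Metric.eventually_nhds_iff.1 hev
  exact ⟨ε, hε, fun t ht => h (by simpa [Real.dist_eq] using ht)⟩

/-- **The strong-coupling rung of the shell maximal-correlation format** (`ShellMaxCorr.ShellRung`), proved. -/
theorem stub_shellRung : ShellRung := by
  intro G _ _ _ _ _ _ _ _ n ρ hρ
  classical
  -- a bound on `Re tr ρ`
  have hcont : Continuous fun g : G => (ρ g).trace.re := Complex.continuous_re.comp hρ.matrix_trace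
  obtain ⟨Mρ, hMρ⟩ := isCompact_univ.exists_bound_of_continuousOn hcont.continuousOn
  have hMρ' : ∀ g : G, |(ρ g).trace.re| ≤ Mρ := fun g => by simpa [Real.norm_eq_abs] using hMρ g (Set.mem_univ g)
  have hMρ0 : 0 ≤ Mρ := (abs_nonneg _).trans (hMρ' 1)
  set cρ : ℝ := 2 * Mρ with hcρ
  -- the smallness function (everything in terms of `δ = cρ |β|`)
  set Lf : ℝ → ℝ := fun δ => 8 * ((4 - 1 : ℕ) : ℝ) *
      ((Real.exp (2 * ((4 - 1 : ℕ) : ℝ) * δ) - Real.exp (-(2 * ((4 - 1 : ℕ) : ℝ) * δ))) ^ 2 +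
        Real.exp (2 * ((4 - 1 : ℕ) : ℝ) * δ) *
          (Real.exp (2 * ((4 - 1 : ℕ) : ℝ) * δ) - Real.exp (-(2 * ((4 - 1 : ℕ) : ℝ) * δ))) *
            (((4 : ℕ) : ℝ) * ((1 + 2 * (3 : ℝ) ^ (4 : ℕ)) * (9 * δ)))) with hLf
  set Ψ : ℝ → ℝ := fun δ => Real.exp (2 * ((4 - 1 : ℕ) : ℝ) * δ) * Lf δ *
      Real.exp (2 * (2 * ((4 - 1 : ℕ) : ℝ) * δ)) - 1 / 4 * (1 - 9 * δ) with hΨ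
  have hΨc : ContinuousAt Ψ 0 := by
    have : Continuous Ψ := by
      simp only [hΨ, hLf]
      fun_prop
    exact this.continuousAt
  have hΨ0 : Ψ 0 < 0 := by simp [hΨ, hLf]
  obtain ⟨ε₁, hε₁, hΨneg⟩ := exists_pos_forall_lt_of_continuousAt hΨc hΨ0
  -- `β₀`
  set β₀ : ℝ := min (ε₁ / (2 * (cρ + 1))) (1 / (1458 * (cρ + 1))) with hβ₀
  have hcρ1 : 0 < cρ + 1 := by positivity
  have hβ₀pos : 0 < β₀ := lt_min (by positivity) (by positivity)
  refine ⟨β₀, hβ₀pos, fun β hβ S R => ?_⟩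
  -- the weight and its oscillation
  set δ : ℝ := cρ * |β| with hδ
  have hδ0 : 0 ≤ δ := by positivity
  have hδε : |δ| < ε₁ := by
    rw [abs_of_nonneg hδ0, hδ]
    have h1 : |β| ≤ ε₁ / (2 * (cρ + 1)) := hβ.trans (min_le_left _ _)
    calc cρ * |β| ≤ cρ * (ε₁ / (2 * (cρ + 1))) := mul_le_mul_of_nonneg_left h1 (by positivity)
      _ < ε₁ := by
          rw [mul_div_assoc']
          rw [div_lt_iff₀ (by positivity)]
          nlinarith
  have hδsmall : (3 : ℝ) ^ 4 * (9 * δ) ≤ 1 / 2 := by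
    have h1 : |β| ≤ 1 / (1458 * (cρ + 1)) := hβ.trans (min_le_right _ _)
    have h2 : cρ * |β| ≤ cρ * (1 / (1458 * (cρ + 1))) := mul_le_mul_of_nonneg_left h1 (by positivity)
    have h3 : cρ * (1 / (1458 * (cρ + 1))) ≤ 1 / 1458 := by
      rw [mul_one_div, div_le_div_iff₀ (by positivity) (by positivity)]
      nlinarith
    rw [hδ]; norm_num; linarith
  have hα1 : 9 * δ < 1 := by norm_num at hδsmall; linarith
  have hΨδ : Real.exp (2 * ((4 - 1 : ℕ) : ℝ) * δ) * Lf δ * Real.exp (2 * (2 * ((4 - 1 : ℕ) : ℝ) * δ)) ≤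
      1 / 4 * (1 - 9 * δ) := by
    have := hΨneg δ hδε; simp only [hΨ] at this; linarith
  -- the single-plaquette weight
  set v : G → ℝ := fun g => Real.exp (-(β * ((n : ℝ) - (ρ g).trace.re))) with hv
  have hvc : Continuous v := (((continuous_const.sub hcont).const_mul β).neg).rexp
  have hv0 : ∀ g, 0 < v g := fun g => Real.exp_pos _
  have hvδ : ∀ a b, |Real.log (v a) - Real.log (v b)| ≤ δ := by
    intro a b
    simp only [hv, Real.log_exp]
    have h1 := hMρ' a
    have h2 := hMρ' b
    calc |-(β * ((n : ℝ) - (ρ a).trace.re)) - -(β * ((n : ℝ) - (ρ b).trace.re))|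
        = |β| * |(ρ a).trace.re - (ρ b).trace.re| := by
          rw [← abs_mul]; congr 1; ring
      _ ≤ |β| * (Mρ + Mρ) := by
          refine mul_le_mul_of_nonneg_left ((abs_sub _ _).trans (add_le_add h1 h2)) (abs_nonneg _)
      _ = δ := by rw [hδ, hcρ]; ring
  -- the torus, the measure, the specification
  set N : ℕ := 2 * S + 1 with hN
  set μ : Measure (GaugeConfig 4 N G) := wilsonMeasure (d := 4) (L := N) ρ β with hμ
  have hμeq : μ = groupHeatKernelMeasure (d := 4) (L := N) (fun _ : ℝ => v) 0 :=
    wilsonMeasure_eq_groupHeatKernelMeasure_rep (d := 4) (L := N) ρ β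
  have hγ : IsSpecification (torusWeightSpec (d := 4) (L := N) v) := isSpecification_torusWeightSpec hvc hv0
  have hGibbs : IsGibbsMeasure (torusWeightSpec (d := 4) (L := N) v) μ := by
    rw [hμeq]; exact isGibbsMeasure_groupHeatKernelMeasure hvc hv0
  haveI : IsProbabilityMeasure μ := hGibbs.isProbabilityMeasure
  have hC := isKRContraction_torusWeightSpec_linear (d := 4) (L := N) hvc hv0 hvδ
  have hrow : ∀ x : Edge 4 N, ∑ y ∈ linkNbrT x, (jointPlaq x y : ℝ) * δ / 2 ≤ 9 * δ := fun x => by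
    have h := sum_linkNbrT_coeff_le_linear (d := 4) (L := N) hδ0 x
    norm_num at h
    linarith
  have hα9 : 3 * (4 - 1 : ℕ) * δ ≤ 9 * δ := by norm_num
  -- the shell bound
  intro f g hfm hgm hfb hgb hf hg
  obtain ⟨Cf, hfC⟩ := hfb
  obtain ⟨Cg, hgC⟩ := hgb
  -- the inside volume `W` = links NOT outside the open ball of radius `R + 1`
  set W : Finset (Edge 4 N) := Finset.univ.filter fun e => ¬ OutBall (R + 1) e with hW
  have hfW : DependsOn f (↑W : Set (Edge 4 N)) := by
    refine hf.mono fun e he => ?_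
    simp only [hW, Finset.coe_filter, Finset.mem_univ, true_and]
    intro hout
    have h1 := he.1; have h2 := hout.1
    omega
  have hgW : DependsOn g ((↑W : Set (Edge 4 N))ᶜ) := by
    refine hg.mono fun e he => ?_
    simp only [hW, Finset.coe_filter, Finset.mem_univ, true_and, Set.mem_compl_iff]
    exact fun h' => h' he
  -- the kernel average `h = γ_W f`
  set h : GaugeConfig 4 N G → ℝ := fun η => ∫ σ, f σ ∂(torusWeightSpec (d := 4) (L := N) v W η) with hh
  have hhm : Measurable h := measurable_kernelAvg hγ W hfm
  have hhC : ∀ η, |h η| ≤ Cf := hγ.abs_integral_le W hfC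
  have hD0 : (0 : ℝ) ≤ 2 * ((4 - 1 : ℕ) : ℝ) * δ := by positivity
  have hgap : 0 ≤ Real.exp (2 * ((4 - 1 : ℕ) : ℝ) * δ) - Real.exp (-(2 * ((4 - 1 : ℕ) : ℝ) * δ)) :=
    sub_nonneg.2 (Real.exp_le_exp.2 (by linarith))
  have hLf0 : 0 ≤ Lf δ := by
    simp only [hLf]
    exact mul_nonneg (by positivity) (add_nonneg (sq_nonneg _)
      (mul_nonneg (mul_nonneg (Real.exp_pos _).le hgap) (by positivity)))
  -- (P)+(B)+(H1)+(H2)+(H3): the variance transfer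
  have key := integral_sq_kernelAvg_sub_le (γ := torusWeightSpec (d := 4) (L := N) v) hγ hC hrow hGibbs W
    (haarProbability G) (K := Real.exp (2 * ((4 - 1 : ℕ) : ℝ) * δ)) (Real.exp_pos _).le
    (fun x η φ hφm hφ0 hφb => integral_siteLaw_torusWeightSpec_le (d := 4) (L := N) hvc hv0 hvδ x η φ hφm hφ0 hφb)
    (fun e s σ => Real.exp (torusLogWeight v (update σ e s) - torusLogWeight v σ))
    (fun e s => measurable_exp_update_sub hvc e s) (ρlo := Real.exp (-(2 * ((4 - 1 : ℕ) : ℝ) * δ)))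
    (ρhi := Real.exp (2 * ((4 - 1 : ℕ) : ℝ) * δ)) (Real.exp_pos _)
    (fun e s σ => exp_update_sub_bounds (d := 4) (L := N) hvδ e s σ)
    (fun x hx s η F hFm _ hF => integral_torusWeightSpec_update_boundary_of_dependsOn hvc hv0 W hx s η F hFm hF)
    (Λ := Lf δ) hLf0
    (fun η sel x _ => gramRow_torusWeightSpec_le (d := 4) (L := N) hvc hv0 hvδ hα9 hδsmall W η sel x)
    hfm hfC hfW
  -- `Var h ≤ ¼ Var f`
  have hquot : Real.exp (2 * ((4 - 1 : ℕ) : ℝ) * δ) * Lf δ / Real.exp (-(2 * ((4 - 1 : ℕ) : ℝ) * δ)) ^ 2 =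
      Real.exp (2 * ((4 - 1 : ℕ) : ℝ) * δ) * Lf δ * Real.exp (2 * (2 * ((4 - 1 : ℕ) : ℝ) * δ)) := by
    rw [div_eq_mul_inv, ← Real.exp_nat_mul, ← Real.exp_neg]
    congr 2; push_cast; ring
  rw [hquot] at key
  have hVf0 : 0 ≤ ∫ σ, (f σ - ∫ τ, f τ ∂μ) ^ 2 ∂μ := integral_nonneg fun σ => sq_nonneg _
  have hVh : ∫ η, (h η - ∫ τ, h τ ∂μ) ^ 2 ∂μ ≤ 1 / 4 * ∫ σ, (f σ - ∫ τ, f τ ∂μ) ^ 2 ∂μ := by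
    have h1 : (1 - 9 * δ) * ∫ η, (h η - ∫ τ, h τ ∂μ) ^ 2 ∂μ ≤
        1 / 4 * (1 - 9 * δ) * ∫ σ, (f σ - ∫ τ, f τ ∂μ) ^ 2 ∂μ :=
      key.trans (mul_le_mul_of_nonneg_right hΨδ hVf0)
    have h2 : 0 < 1 - 9 * δ := by linarith
    nlinarith
  -- `Cov(f, g) = Cov(h, g)` and Cauchy–Schwarz
  have hcovf : cov[f, g; μ] = cov[h, g; μ] := by
    rw [cov_eq_integral μ hfm hfC hgm hgC, cov_eq_integral μ hhm hhC hgm hgC,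
      ← integral_kernelAvg_mul hγ hGibbs W hfm hgm hfC hgC hgW, ← integral_kernelAvg hγ hGibbs W hfm hfC]
  rw [hcovf]
  refine (abs_cov_le_sqrt_var μ hhm hgm hhC hgC).trans ?_
  have hvarh : Real.sqrt (Var[h; μ]) ≤ 1 / 2 * Real.sqrt (Var[f; μ]) := by
    rw [variance_eq_integral hhm.aemeasurable, variance_eq_integral hfm.aemeasurable]
    calc Real.sqrt (∫ η, (h η - ∫ τ, h τ ∂μ) ^ 2 ∂μ)
        ≤ Real.sqrt (1 / 4 * ∫ σ, (f σ - ∫ τ, f τ ∂μ) ^ 2 ∂μ) := Real.sqrt_le_sqrt hVh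
      _ = 1 / 2 * Real.sqrt (∫ σ, (f σ - ∫ τ, f τ ∂μ) ^ 2 ∂μ) := by
          rw [Real.sqrt_mul' _ hVf0,
            show Real.sqrt (1 / 4 : ℝ) = 1 / 2 by
              rw [show (1 / 4 : ℝ) = (1 / 2) ^ 2 by norm_num, Real.sqrt_sq (by norm_num)]]
  calc Real.sqrt (Var[h; μ]) * Real.sqrt (Var[g; μ]) ≤ 1 / 2 * Real.sqrt (Var[f; μ]) * Real.sqrt (Var[g; μ]) :=
        mul_le_mul_of_nonneg_right hvarh (Real.sqrt_nonneg _)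
    _ = 1 / 2 * Real.sqrt (Var[f; μ]) * Real.sqrt (Var[g; μ]) := rfl

end Rung

end Summit.QuantumFields.YangMills.Cruxes.IR.ShellMaxCorr

end
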